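import Summits.CriticalPhenomena.PercolationContinuityZ3.Theorems.PercNearOneGluingNoHeavyQuantCatHullLight
import Summits.CriticalPhenomena.PercolationContinuityZ3.Theorems.PercNearOneGluingNoHeavyQuantCatHullLightSplit
import HarnessLib

/-!
# QUANT lane R8, T-DEC: ROUTE 2 ASSEMBLED BY NAME — `CatPairLight ∧ HeavyGateLight ∧ HeavyBelowHalf ⟹ TreeBuiltCatHullLight ⟹ FarTreeRow`
# and the converses `TreeBuiltCatHullLight ⟹ HeavyGateLight`, `TreeBuiltCatHullLight ⟹ HeavyBelowHalf` (lead g47 V432/V433 ask to the typer)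

builds on p205010 (kernel theorem, internal audit signed; external expert review pending)

Support file (`--supports stmt-CriticalPhenomena-4575`), QUANT lane typer seat prim-quant-stmt (gen 41).  Theorems only (one-liners), standard axioms,
no sorries.  Joins typer g41's `…QuantCatHullLight` (✓ p419856: `TreeBuiltCatHullBelow`, `@[conjecture] TreeBuiltCatHullLight`,
`farTreeRow_of_treeBuiltCatHullLight`) with lead g47's `…QuantCatHullLightSplit` (✓ p424685: census-2 g75's decomposition `@[conjecture] CatPairLight` (P),
`HeavyGateLight` (G), `HeavyBelowHalf` (M) and `treeBuiltCatHullBelow_half_of_split`, stated there against the UNFOLDED body of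
`TreeBuiltCatHullBelow (1/2)` because the farm had not yet built `…CatHullLight`).
* **`treeBuiltCatHullLight_of_split`** : (P) → (G) → (M) → `TreeBuiltCatHullLight`; `treeBuiltFARLight_of_catHullSplit`;
  **`Quant.farTreeRow_of_catHullSplit`** : (P) → (G) → (M) → `FarTreeRow` (unconditional);
* converses **`heavyBelowHalf_of_catHullLight`** ((M) is the `TreeBuilt.mono` instance of the node) and **`heavyGateLight_of_catHullLight`** ((G) is
  the `TreeBuilt.gate` instance; `q·x < 1/2 ≤ x` forces `q ≤ 1`); hence **`treeBuiltCatHullLight_iff_of_catPairLight`** : (P) → (`TreeBuiltCatHullLight`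
  ↔ (G) ∧ (M)).  The converse of (P) would need the two caterpillar columns to be tree-built AT the floor (blob gates strictly above it), so it is not
  claimed.

HONEST STATUS: all four statements are evidence-level conjectures (lead g47 CENSUS-CATHULL-G47: ≈ 280 exact instances, every light one IN, width-2 gapped
pairs leave the hull exactly at natural floor 1/2); `TreeBuiltFARLight`, `FarTreeRow` OPEN; node of record `ResidDEC` (V431); RATE class log\* / honest
sentence of `run/shared/lean/prim/quant/README.md` unchanged.  [this work].  Nothing here is cited as a published result.  The gluing rows served
[cite: KozmaNitzan2024, Conjecture 3 (p. 15)]; product measure [cite: Grimmett1999, §1.3 p. 10].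
-/

noncomputable section

open scoped BigOperators

namespace Summit.CriticalPhenomena.PercolationContinuityZ3.Theorems
namespace Quant
namespace LawDec

open Finset

/-- **(P) ∧ (G) ∧ (M) ⟹ `TreeBuiltCatHullLight`** (lead g47's `treeBuiltCatHullBelow_half_of_split`, by name). [this work] -/
theorem treeBuiltCatHullLight_of_split (hP : CatPairLight) (hG : HeavyGateLight) (hM : HeavyBelowHalf) : TreeBuiltCatHullLight :=
  treeBuiltCatHullBelow_half_of_split hP hG hM

/-- (P) ∧ (G) ∧ (M) ⟹ `TreeBuiltFARLight`. [this work] -/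
theorem treeBuiltFARLight_of_catHullSplit (hP : CatPairLight) (hG : HeavyGateLight) (hM : HeavyBelowHalf) : TreeBuiltFARLight :=
  treeBuiltFARLight_of_catHullLight (treeBuiltCatHullLight_of_split hP hG hM)

/-- **CONVERSE (M)**: the light node gives every heavy tree-built law at every light floor (`TreeBuilt.mono`). [this work] -/
theorem heavyBelowHalf_of_catHullLight (h : TreeBuiltCatHullLight) : HeavyBelowHalf :=
  fun x M ν hT hx x' hx'0 hx'1 => h x' M ν (TreeBuilt.mono hT hx'0 (by linarith)) hx'1

/-- **CONVERSE (G)**: the light node gives every light gate of a heavy tree-built law (`TreeBuilt.gate`; `q·x < 1/2 ≤ x` forces `q ≤ 1`; the mean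
of `gate ν q` is `q·mean ν`, `sum_mul_gate`). [this work] -/
theorem heavyGateLight_of_catHullLight (h : TreeBuiltCatHullLight) : HeavyGateLight := by
  intro x M ν hT hx q hq0 hqx
  have hx0 : 0 < x := (treeBuilt_lawFacts hT).1
  have hq1 : q ≤ 1 := by
    by_contra hq
    have : x < q * x := by nlinarith [not_le.1 hq]
    linarith
  have key := h (q * x) M (gate ν q) (TreeBuilt.gate q hq0 hq1 hT) hqx
  rwa [sum_mul_gate] at key

/-- **GIVEN THE PAIR LEMMA, THE LIGHT NODE IS EQUIVALENT TO (G) ∧ (M).** [this work] -/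
theorem treeBuiltCatHullLight_iff_of_catPairLight (hP : CatPairLight) :
    TreeBuiltCatHullLight ↔ HeavyGateLight ∧ HeavyBelowHalf :=
  ⟨fun h => ⟨heavyGateLight_of_catHullLight h, heavyBelowHalf_of_catHullLight h⟩,
    fun h => treeBuiltCatHullLight_of_split hP h.1 h.2⟩

end LawDec

/-- **(P) ∧ (G) ∧ (M) ⟹ `Quant.FarTreeRow`, UNCONDITIONALLY** (route 2 assembled: `farTreeRow_of_treeBuiltCatHullLight`, heavy half
`farTreeRowHeavy_holds`). [this work] -/
theorem farTreeRow_of_catHullSplit (hP : LawDec.CatPairLight) (hG : LawDec.HeavyGateLight) (hM : LawDec.HeavyBelowHalf) : FarTreeRow :=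
  farTreeRow_of_treeBuiltCatHullLight (LawDec.treeBuiltCatHullLight_of_split hP hG hM)

end Quant
end Summit.CriticalPhenomena.PercolationContinuityZ3.Theorems
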